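import Summits.Ventures.YMGap.Conjectures.ChiralClockComparisonSingleEdge
import HarnessLib

/-!
# Venture YMGap — Conjectures/ChiralClockComparisonLeaf.lean: LEAF STRIPPING for the typed conjecture (C) `ChiralClockComparison`
# — a vertex coupled to at most one other vertex factorises off, and the comparison inequality survives the stripping

HONEST FRAMING (venture `Summits/Ventures/YMGap`, cell `pub-ymgap`, track Y2 ROBUST-BALL, seat ds-4 g15).  Theorems only (finite sums over
`Fin n → ZMod 3`; no measure theory, no gauge fields); the conjecture `ChiralClockComparison` (file `Conjectures/ChiralClockComparison.lean`, the
one open point of the centre-blind `β`-ladder for odd `N`) is NOT proved here and keeps its status.  What this file proves, for the chiral `ℤ₃`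
clock model `w(k) = exp(∑_{u,v} a_{uv} cos(2π(k_u − k_v)/3 + φ_{uv}))` on `Fin n` of that file:

* `sum_mul_apply_sub_eq_of_update` — THE LEAF IDENTITY: if `G(k)` does not depend on the spin `k_x` and `x ≠ y`, then
  `∑_k G(k) f(k_x − k_y) = ((∑_d f d)/3) ∑_k G(k)` (shift `k_x ↦ k_x + c`, average over `c ∈ ℤ₃`);
* `chiralClockCorr_eq_zero_of_isolated` — an uncoupled vertex `b` has `⟨ω^{k_b − k_t}⟩ = 0` for `t ≠ b` (`∑_d ω^d = 0`);
* `conj_chiralClockCorr_zero`, `chiralClockCorr_zero_im` — at zero phases the two-point function is REAL (spin flip `k ↦ −k`);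
* the STRIPPING IDENTITIES for a vertex `x` coupled only to `y` (`a_{xz} = a_{zx} = 0` for `z ∉ {x, y}`), with `a'` = `a` minus the two
  entries `(x,y)`, `(y,x)`: `⟨ω^{k_b−k_t}⟩_a = ⟨ω^{k_b−k_t}⟩_{a'}` for `b, t ≠ x` (`chiralClockCorr_strip_eq_of_ne`),
  `⟨ω^{k_x−k_t}⟩_a = τ · ⟨ω^{k_y−k_t}⟩_{a'}` (`chiralClockCorr_strip_eq_mul_left`) and `⟨ω^{k_b−k_x}⟩_a = τ' · ⟨ω^{k_b−k_y}⟩_{a'}`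
  (`chiralClockCorr_strip_eq_mul_right`), where `τ, τ'` are the two-point functions of the TWO-VERTEX model carrying the edge `{x, y}`
  alone — so the single-edge theorem `chiralClockComparison_two` (file `ChiralClockComparisonSingleEdge.lean`) controls them;
The sequel `Conjectures/ChiralClockComparisonForest.lean` turns these into `chiralClockComparison_stripLeaf` (the comparison inequality
survives the stripping) and iterates: (C) holds whenever the support graph of `a` is a FOREST, and (C) in general reduces to coupling
graphs without vertices of degree one.  Reference for the mechanism (the `ℤ₂` case): G. Mack, V. B. Petkova,
Ann. Phys. 123 (1979) 442 [cite: MackPetkova1979, §2]; on trees nearest-neighbour correlations factorise over the path (R. B. Griffiths 1967).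
-/

noncomputable section

open Real Finset
open scoped ComplexConjugate

namespace Summit.Ventures.YMGap.Conjectures

variable {n : ℕ}

/-! ### Arithmetic of `ℤ₃` and of the cube roots of unity -/

/-- Every element of `ℤ₃` is `0`, `1` or `2`. [folklore] -/
theorem zmod_three_cases (d : ZMod 3) : d = 0 ∨ d = 1 ∨ d = 2 := by
  revert d; decide

/-- `ω^{d₁ + d₂} = ω^{d₁} ω^{d₂}`: `omegaPow` is a character of `ℤ₃`. [folklore] -/
theorem omegaPow_add (d₁ d₂ : ZMod 3) : omegaPow (d₁ + d₂) = omegaPow d₁ * omegaPow d₂ := by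
  have h33 : (√3 : ℝ) * √3 = 3 := Real.mul_self_sqrt (by norm_num)
  have e11 : (1 : ZMod 3) + 1 = 2 := by decide
  have e12 : (1 : ZMod 3) + 2 = 0 := by decide
  have e21 : (2 : ZMod 3) + 1 = 0 := by decide
  have e22 : (2 : ZMod 3) + 2 = 1 := by decide
  rcases zmod_three_cases d₁ with rfl | rfl | rfl <;> rcases zmod_three_cases d₂ with rfl | rfl | rfl <;>
    simp only [add_zero, zero_add, e11, e12, e21, e22, omegaPow_zero, omegaPow_one, omegaPow_two, one_mul, mul_one] <;>
    apply Complex.ext <;> simp <;> nlinarith [h33]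

/-- `ω^{−d} = conj(ω^d)`. [folklore] -/
theorem omegaPow_neg (d : ZMod 3) : omegaPow (-d) = conj (omegaPow d) := by
  have e1 : -(1 : ZMod 3) = 2 := by decide
  have e2 : -(2 : ZMod 3) = 1 := by decide
  rcases zmod_three_cases d with rfl | rfl | rfl
  · simp [omegaPow_zero]
  · rw [e1, omegaPow_two, omegaPow_one]
    apply Complex.ext <;> simp
  · rw [e2, omegaPow_one, omegaPow_two]
    apply Complex.ext <;> simp

/-- At zero phase the single-pair profile is even in `d`: `cos(2π(−d).val/3 + 0) = cos(2π d.val/3 + 0)` on `ℤ₃`. [folklore] -/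
theorem cos_val_neg_zmod_three (d : ZMod 3) :
    Real.cos (2 * π * (((-d).val : ℕ) : ℝ) / 3 + 0) = Real.cos (2 * π * ((d.val : ℕ) : ℝ) / 3 + 0) := by
  have e1 : -(1 : ZMod 3) = 2 := by decide
  have e2 : -(2 : ZMod 3) = 1 := by decide
  have v1 : (1 : ZMod 3).val = 1 := by decide
  have v2 : (2 : ZMod 3).val = 2 := by decide
  have key : Real.cos (2 * π * ((2 : ℕ) : ℝ) / 3 + 0) = Real.cos (2 * π * ((1 : ℕ) : ℝ) / 3 + 0) := by
    rw [add_zero, add_zero, Nat.cast_one, Nat.cast_ofNat, mul_one, show 2 * π * 2 / 3 = 4 * π / 3 by ring,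
      cos_four_pi_div_three, Literature.Probability.LatticeModels.DiluteA22.cos_two_pi_div_three]
  rcases zmod_three_cases d with rfl | rfl | rfl
  · rw [neg_zero]
  · rw [e1, v1, v2, key]
  · rw [e2, v1, v2, key]

/-! ### The leaf identity: averaging over the spin at an (almost) free vertex -/

/-- **LEAF IDENTITY.**  If `G : (Fin n → ℤ₃) → ℂ` does not depend on the spin at `x` and `x ≠ y`, then for every `f : ℤ₃ → ℂ`,
`∑_k G(k)·f(k_x − k_y) = ((∑_d f(d))/3)·∑_k G(k)` (the shift `k_x ↦ k_x + c` is a bijection of configurations fixing `G`; average over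
`c ∈ ℤ₃`). [folklore] -/
theorem sum_mul_apply_sub_eq_of_update {x y : Fin n} (hxy : x ≠ y) (G : (Fin n → ZMod 3) → ℂ)
    (hG : ∀ k m, G (Function.update k x m) = G k) (f : ZMod 3 → ℂ) :
    ∑ k : Fin n → ZMod 3, G k * f (k x - k y) = (∑ d, f d) / 3 * ∑ k : Fin n → ZMod 3, G k := by
  -- shifting the spin at `x` by `c`
  have hshift : ∀ c : ZMod 3, ∑ k : Fin n → ZMod 3, G k * f (k x - k y) =
      ∑ k : Fin n → ZMod 3, G k * f (k x - k y + c) := by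
    intro c
    have hbij : Function.Bijective (fun k : Fin n → ZMod 3 => Function.update k x (k x + c)) := by
      refine Finite.injective_iff_bijective.1 fun k k' h => ?_
      have h' : ∀ u, Function.update k x (k x + c) u = Function.update k' x (k' x + c) u := fun u => congr_fun h u
      have hx : k x = k' x := by
        have := h' x
        simpa [Function.update_self] using this
      funext u
      by_cases hu : u = x
      · rw [hu, hx]
      · have := h' u
        simpa [Function.update_of_ne hu] using this
    rw [← hbij.sum_comp (fun k => G k * f (k x - k y))]
    refine Finset.sum_congr rfl fun k _ => ?_
    simp only [Function.update_self, Function.update_of_ne hxy.symm, hG]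
    ring_nf
  -- average over `c`
  have h3 : (3 : ℂ) * ∑ k : Fin n → ZMod 3, G k * f (k x - k y) =
      ∑ k : Fin n → ZMod 3, G k * ∑ d, f d := by
    have hc : ∑ c : ZMod 3, ∑ k : Fin n → ZMod 3, G k * f (k x - k y + c) =
        ∑ c : ZMod 3, ∑ k : Fin n → ZMod 3, G k * f (k x - k y) :=
      Finset.sum_congr rfl fun c _ => (hshift c).symm
    rw [Finset.sum_const, Finset.card_univ, ZMod.card, nsmul_eq_mul, Nat.cast_ofNat] at hc
    rw [← hc, Finset.sum_comm]
    refine Finset.sum_congr rfl fun k _ => ?_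
    rw [Finset.mul_sum]
    exact Fintype.sum_equiv (Equiv.addLeft (k x - k y)) _ _ fun c => rfl
  have h3' : ∑ k : Fin n → ZMod 3, G k * f (k x - k y) = (∑ k : Fin n → ZMod 3, G k * ∑ d, f d) / 3 := by
    rw [← h3]; field_simp
  rw [h3', ← Finset.sum_mul]
  ring

/-- The weight does not depend on the spin at a vertex `x` all of whose off-diagonal couplings vanish. [folklore] -/
theorem chiralClockWeight_update_of_isolated {x : Fin n} {a : Fin n → Fin n → ℝ} (hrow : ∀ v, v ≠ x → a x v = 0)
    (hcol : ∀ u, u ≠ x → a u x = 0) (φ : Fin n → Fin n → ℝ) (k : Fin n → ZMod 3) (m : ZMod 3) :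
    chiralClockWeight a φ (Function.update k x m) = chiralClockWeight a φ k := by
  unfold chiralClockWeight
  congr 1
  refine Finset.sum_congr rfl fun u _ => Finset.sum_congr rfl fun v _ => ?_
  by_cases hu : u = x
  · by_cases hv : v = x
    · simp [hu, hv]
    · simp [hu, hrow v hv]
  · by_cases hv : v = x
    · simp [hv, hcol u hu]
    · simp [Function.update_of_ne hu, Function.update_of_ne hv]

/-- **AN UNCOUPLED VERTEX HAS VANISHING TWO-POINT FUNCTION**: if `a_{bz} = a_{zb} = 0` for all `z ≠ b` then `⟨ω^{k_b − k_t}⟩_{a,φ} = 0`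
for every `t ≠ b` (the leaf identity with `f = ω^{·}`, `∑_d ω^d = 0`). [folklore] -/
theorem chiralClockCorr_eq_zero_of_isolated {b t : Fin n} (hbt : b ≠ t) {a : Fin n → Fin n → ℝ}
    (hiso : ∀ z, z ≠ b → a b z = 0 ∧ a z b = 0) (φ : Fin n → Fin n → ℝ) : chiralClockCorr a φ b t = 0 := by
  unfold chiralClockCorr
  rw [sum_mul_apply_sub_eq_of_update hbt (fun k => (chiralClockWeight a φ k : ℂ))
    (fun k m => by simp only [chiralClockWeight_update_of_isolated (fun v hv => (hiso v hv).1) (fun u hu => (hiso u hu).2)])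
    omegaPow]
  rw [sum_zmod_three, omegaPow_zero, omegaPow_one, omegaPow_two]
  have : (1 : ℂ) + ⟨-1 / 2, √3 / 2⟩ + ⟨-1 / 2, -(√3 / 2)⟩ = 0 := by
    apply Complex.ext <;> norm_num
  rw [this]; simp

/-! ### Zero phases: the two-point function is real -/

/-- At zero phases the weight is invariant under the global spin flip `k ↦ −k`. [folklore] -/
theorem chiralClockWeight_zero_neg (a : Fin n → Fin n → ℝ) (k : Fin n → ZMod 3) :
    chiralClockWeight a (fun _ _ => 0) (-k) = chiralClockWeight a (fun _ _ => 0) k := by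
  unfold chiralClockWeight
  congr 1
  refine Finset.sum_congr rfl fun u _ => Finset.sum_congr rfl fun v _ => ?_
  rw [Pi.neg_apply, Pi.neg_apply, ← neg_sub', cos_val_neg_zmod_three]

/-- **At zero phases the two-point function is real**: `conj ⟨ω^{k_b − k_t}⟩_{a,0} = ⟨ω^{k_b − k_t}⟩_{a,0}` (spin flip). [folklore] -/
theorem conj_chiralClockCorr_zero (a : Fin n → Fin n → ℝ) (b t : Fin n) :
    conj (chiralClockCorr a (fun _ _ => 0) b t) = chiralClockCorr a (fun _ _ => 0) b t := by
  unfold chiralClockCorr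
  rw [map_div₀, map_sum, map_sum]
  congr 1
  · rw [← Equiv.sum_comp (Equiv.neg (Fin n → ZMod 3))
      (fun k => (chiralClockWeight a (fun _ _ => 0) k : ℂ) * omegaPow (k b - k t))]
    refine Finset.sum_congr rfl fun k _ => ?_
    rw [map_mul, Complex.conj_ofReal, Equiv.neg_apply, chiralClockWeight_zero_neg, Pi.neg_apply, Pi.neg_apply, ← neg_sub',
      omegaPow_neg]
  · exact Finset.sum_congr rfl fun k _ => Complex.conj_ofReal _

/-- At zero phases `Im ⟨ω^{k_b − k_t}⟩_{a,0} = 0`. [folklore] -/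
theorem chiralClockCorr_zero_im (a : Fin n → Fin n → ℝ) (b t : Fin n) : (chiralClockCorr a (fun _ _ => 0) b t).im = 0 :=
  Complex.conj_eq_iff_im.1 (conj_chiralClockCorr_zero a b t)

/-! ### Stripping a leaf: the factorisation identities -/

/-- The weight with the two entries `(x,y)`, `(y,x)` separated: if `a'` agrees with `a` except `a'_{xy} = a'_{yx} = 0`, then
`w_a(k) = w_{a'}(k) · exp(a_{xy} cos(2π(k_x−k_y)/3 + φ_{xy}) + a_{yx} cos(2π(k_y−k_x)/3 + φ_{yx}))`. [folklore] -/
theorem chiralClockWeight_eq_mul_of_strip {x y : Fin n} (hxy : x ≠ y) {a a' : Fin n → Fin n → ℝ} (hxy' : a' x y = 0)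
    (hyx' : a' y x = 0) (haa' : ∀ u v, ¬(u = x ∧ v = y) → ¬(u = y ∧ v = x) → a' u v = a u v) (φ : Fin n → Fin n → ℝ)
    (k : Fin n → ZMod 3) :
    chiralClockWeight a φ k = chiralClockWeight a' φ k *
      Real.exp (a x y * Real.cos (2 * π * (((k x - k y).val : ℕ) : ℝ) / 3 + φ x y) +
        a y x * Real.cos (2 * π * (((k y - k x).val : ℕ) : ℝ) / 3 + φ y x)) := by
  unfold chiralClockWeight
  rw [← Real.exp_add]
  congr 1
  set c : Fin n → Fin n → ℝ := fun u v => Real.cos (2 * π * (((k u - k v).val : ℕ) : ℝ) / 3 + φ u v) with hc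
  have hdiff : ∑ u, ∑ v, a u v * c u v - ∑ u, ∑ v, a' u v * c u v = a x y * c x y + a y x * c y x := by
    rw [← Finset.sum_sub_distrib]
    simp_rw [← Finset.sum_sub_distrib, ← sub_mul]
    rw [← Fintype.sum_prod_type' (f := fun u v => (a u v - a' u v) * c u v)]
    rw [Fintype.sum_eq_add (x, y) (y, x) (by simp [Prod.ext_iff, hxy]) ?_]
    · simp [hxy', hyx']
    · rintro ⟨u, v⟩ ⟨h1, h2⟩
      have := haa' u v (by simpa [Prod.ext_iff] using h1) (by simpa [Prod.ext_iff] using h2)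
      simp [this]
  show ∑ u, ∑ v, a u v * c u v = ∑ u, ∑ v, a' u v * c u v + (a x y * c x y + a y x * c y x)
  linarith

/-- The two-vertex model carrying the edge `{x, y}`: with `a₂ i j = a (![x,y] i) (![x,y] j)`, `φ₂` likewise, the quotients of sums of
`Conjectures/ChiralClockComparison.lean` on `Fin 2` reduce to three-term sums
`∑_d exp(a_{xy} cos(2πd/3 + φ_{xy}) + a_{yx} cos(2π(−d)/3 + φ_{yx}))·h(d)` (`sum_weight_two`). [folklore] -/
theorem chiralClockCorr_pair_eq (x y : Fin n) (a φ : Fin n → Fin n → ℝ) (h : ZMod 3 → ℂ) :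
    (∑ k : Fin 2 → ZMod 3, (chiralClockWeight (fun i j => a (![x, y] i) (![x, y] j)) (fun i j => φ (![x, y] i) (![x, y] j)) k : ℂ) *
        h (k 0 - k 1)) /
      (∑ k : Fin 2 → ZMod 3, (chiralClockWeight (fun i j => a (![x, y] i) (![x, y] j)) (fun i j => φ (![x, y] i) (![x, y] j)) k : ℂ)) =
      (∑ d : ZMod 3, (Real.exp (a x y * Real.cos (2 * π * ((d.val : ℕ) : ℝ) / 3 + φ x y) +
          a y x * Real.cos (2 * π * (((-d).val : ℕ) : ℝ) / 3 + φ y x)) : ℂ) * h d) /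
        ∑ d : ZMod 3, (Real.exp (a x y * Real.cos (2 * π * ((d.val : ℕ) : ℝ) / 3 + φ x y) +
          a y x * Real.cos (2 * π * (((-d).val : ℕ) : ℝ) / 3 + φ y x)) : ℂ) := by
  set a₂ : Fin 2 → Fin 2 → ℝ := fun i j => a (![x, y] i) (![x, y] j) with ha₂
  set φ₂ : Fin 2 → Fin 2 → ℝ := fun i j => φ (![x, y] i) (![x, y] j) with hφ₂
  have hD := sum_weight_two a₂ φ₂ (fun _ => 1)
  simp only [mul_one] at hD
  have hE : ∀ d : ZMod 3, edgeProfile a₂ φ₂ d = a x y * Real.cos (2 * π * ((d.val : ℕ) : ℝ) / 3 + φ x y) +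
      a y x * Real.cos (2 * π * (((-d).val : ℕ) : ℝ) / 3 + φ y x) := by
    intro d; simp [edgeProfile, ha₂, hφ₂]
  have hne : (3 * (Real.exp (a₂ 0 0 * Real.cos (φ₂ 0 0) + a₂ 1 1 * Real.cos (φ₂ 1 1)) : ℂ)) ≠ 0 := by
    have : (0 : ℝ) < 3 * Real.exp (a₂ 0 0 * Real.cos (φ₂ 0 0) + a₂ 1 1 * Real.cos (φ₂ 1 1)) := by positivity
    exact_mod_cast this.ne'
  rw [sum_weight_two, hD, mul_div_mul_left _ _ hne, sum_zmod_three, sum_zmod_three, hE, hE, hE]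

section Strip

variable {x y : Fin n} {a a' : Fin n → Fin n → ℝ}

/-- After stripping, the weight no longer depends on the spin at the leaf `x`. [folklore] -/
theorem chiralClockWeight_strip_update (hleaf : ∀ z, z ≠ x → z ≠ y → a x z = 0 ∧ a z x = 0) (hxy' : a' x y = 0)
    (hyx' : a' y x = 0) (haa' : ∀ u v, ¬(u = x ∧ v = y) → ¬(u = y ∧ v = x) → a' u v = a u v) (φ : Fin n → Fin n → ℝ)
    (k : Fin n → ZMod 3) (m : ZMod 3) : chiralClockWeight a' φ (Function.update k x m) = chiralClockWeight a' φ k := by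
  refine chiralClockWeight_update_of_isolated (fun v hv => ?_) (fun u hu => ?_) φ k m
  · by_cases hvy : v = y
    · rw [hvy, hxy']
    · rw [haa' x v (fun h => hvy h.2) (fun h => hv h.2), (hleaf v hv hvy).1]
  · by_cases huy : u = y
    · rw [huy, hyx']
    · rw [haa' u x (fun h => hu h.1) (fun h => huy h.1), (hleaf u hu huy).2]

/-- **STRIPPING IDENTITY, pairs avoiding the leaf**: for `b, t ≠ x`, `⟨ω^{k_b−k_t}⟩_a = ⟨ω^{k_b−k_t}⟩_{a'}` (the leaf factor
`F₀/3` cancels between numerator and denominator). [folklore] -/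
theorem chiralClockCorr_strip_eq_of_ne (hxy : x ≠ y) (hleaf : ∀ z, z ≠ x → z ≠ y → a x z = 0 ∧ a z x = 0) (hxy' : a' x y = 0)
    (hyx' : a' y x = 0) (haa' : ∀ u v, ¬(u = x ∧ v = y) → ¬(u = y ∧ v = x) → a' u v = a u v) (φ : Fin n → Fin n → ℝ)
    {b t : Fin n} (hb : b ≠ x) (ht : t ≠ x) : chiralClockCorr a φ b t = chiralClockCorr a' φ b t := by
  -- the leaf factor as a function of `d = k_x - k_y`
  obtain ⟨E, hE⟩ : ∃ E : ZMod 3 → ℂ, ∀ d, E d = (Real.exp (a x y * Real.cos (2 * π * ((d.val : ℕ) : ℝ) / 3 + φ x y) +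
      a y x * Real.cos (2 * π * (((-d).val : ℕ) : ℝ) / 3 + φ y x)) : ℂ) := ⟨_, fun d => rfl⟩
  have hw : ∀ k : Fin n → ZMod 3, (chiralClockWeight a φ k : ℂ) = (chiralClockWeight a' φ k : ℂ) * E (k x - k y) := by
    intro k
    rw [chiralClockWeight_eq_mul_of_strip hxy hxy' hyx' haa' φ k, hE, Complex.ofReal_mul, neg_sub]
  have hupd := chiralClockWeight_strip_update hleaf hxy' hyx' haa' φ
  have hE0 : (∑ d, E d) ≠ 0 := by
    simp_rw [hE]
    rw [← Complex.ofReal_sum]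
    have : (0 : ℝ) < ∑ d : ZMod 3, Real.exp (a x y * Real.cos (2 * π * ((d.val : ℕ) : ℝ) / 3 + φ x y) +
        a y x * Real.cos (2 * π * (((-d).val : ℕ) : ℝ) / 3 + φ y x)) :=
      Finset.sum_pos (fun d _ => Real.exp_pos _) Finset.univ_nonempty
    exact_mod_cast this.ne'
  unfold chiralClockCorr
  simp_rw [hw]
  have e1 : ∀ k : Fin n → ZMod 3, (chiralClockWeight a' φ k : ℂ) * E (k x - k y) * omegaPow (k b - k t) =
      (chiralClockWeight a' φ k : ℂ) * omegaPow (k b - k t) * E (k x - k y) := fun k => mul_right_comm _ _ _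
  have hnum : ∑ k : Fin n → ZMod 3, (chiralClockWeight a' φ k : ℂ) * E (k x - k y) * omegaPow (k b - k t) =
      (∑ d, E d) / 3 * ∑ k : Fin n → ZMod 3, (chiralClockWeight a' φ k : ℂ) * omegaPow (k b - k t) := by
    simp_rw [e1]
    exact sum_mul_apply_sub_eq_of_update hxy (fun k => (chiralClockWeight a' φ k : ℂ) * omegaPow (k b - k t))
      (fun k m => by simp only [hupd, Function.update_of_ne hb, Function.update_of_ne ht]) E
  have hden : ∑ k : Fin n → ZMod 3, (chiralClockWeight a' φ k : ℂ) * E (k x - k y) =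
      (∑ d, E d) / 3 * ∑ k : Fin n → ZMod 3, (chiralClockWeight a' φ k : ℂ) :=
    sum_mul_apply_sub_eq_of_update hxy (fun k => (chiralClockWeight a' φ k : ℂ)) (fun k m => by simp only [hupd]) E
  rw [hnum, hden, mul_div_mul_left]
  exact div_ne_zero hE0 (by norm_num)

/-- **STRIPPING IDENTITY at the leaf, left slot**: for `t ≠ x`, `⟨ω^{k_x−k_t}⟩_a = τ · ⟨ω^{k_y−k_t}⟩_{a'}` with `τ = ⟨ω^{k_0−k_1}⟩` of
the two-vertex model `a₂ i j = a (![x,y] i) (![x,y] j)` carrying the edge alone. [folklore] -/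
theorem chiralClockCorr_strip_eq_mul_left (hxy : x ≠ y) (hleaf : ∀ z, z ≠ x → z ≠ y → a x z = 0 ∧ a z x = 0) (hxy' : a' x y = 0)
    (hyx' : a' y x = 0) (haa' : ∀ u v, ¬(u = x ∧ v = y) → ¬(u = y ∧ v = x) → a' u v = a u v) (φ : Fin n → Fin n → ℝ)
    {t : Fin n} (ht : t ≠ x) :
    chiralClockCorr a φ x t =
      chiralClockCorr (fun i j => a (![x, y] i) (![x, y] j)) (fun i j => φ (![x, y] i) (![x, y] j)) 0 1 * chiralClockCorr a' φ y t := by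
  obtain ⟨E, hE⟩ : ∃ E : ZMod 3 → ℂ, ∀ d, E d = (Real.exp (a x y * Real.cos (2 * π * ((d.val : ℕ) : ℝ) / 3 + φ x y) +
      a y x * Real.cos (2 * π * (((-d).val : ℕ) : ℝ) / 3 + φ y x)) : ℂ) := ⟨_, fun d => rfl⟩
  have hw : ∀ k : Fin n → ZMod 3, (chiralClockWeight a φ k : ℂ) = (chiralClockWeight a' φ k : ℂ) * E (k x - k y) := by
    intro k
    rw [chiralClockWeight_eq_mul_of_strip hxy hxy' hyx' haa' φ k, hE, Complex.ofReal_mul, neg_sub]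
  have hupd := chiralClockWeight_strip_update hleaf hxy' hyx' haa' φ
  have hE0 : (∑ d, E d) ≠ 0 := by
    simp_rw [hE]
    rw [← Complex.ofReal_sum]
    have : (0 : ℝ) < ∑ d : ZMod 3, Real.exp (a x y * Real.cos (2 * π * ((d.val : ℕ) : ℝ) / 3 + φ x y) +
        a y x * Real.cos (2 * π * (((-d).val : ℕ) : ℝ) / 3 + φ y x)) :=
      Finset.sum_pos (fun d _ => Real.exp_pos _) Finset.univ_nonempty
    exact_mod_cast this.ne'
  have hZ' : ∑ k : Fin n → ZMod 3, (chiralClockWeight a' φ k : ℂ) ≠ 0 := sum_chiralClockWeight_ne_zero a' φ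
  -- the pair model
  have hpair : chiralClockCorr (fun i j => a (![x, y] i) (![x, y] j)) (fun i j => φ (![x, y] i) (![x, y] j)) 0 1 =
      (∑ d, E d * omegaPow d) / ∑ d, E d := by
    unfold chiralClockCorr
    rw [chiralClockCorr_pair_eq x y a φ omegaPow]
    simp_rw [hE]
  -- the big model
  rw [hpair]
  unfold chiralClockCorr
  simp_rw [hw]
  have e1 : ∀ k : Fin n → ZMod 3, (chiralClockWeight a' φ k : ℂ) * E (k x - k y) * omegaPow (k x - k t) =
      (chiralClockWeight a' φ k : ℂ) * omegaPow (k y - k t) * (E (k x - k y) * omegaPow (k x - k y)) := by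
    intro k
    have : k x - k t = (k x - k y) + (k y - k t) := by ring
    rw [this, omegaPow_add]; ring
  have hnum : ∑ k : Fin n → ZMod 3, (chiralClockWeight a' φ k : ℂ) * E (k x - k y) * omegaPow (k x - k t) =
      (∑ d, E d * omegaPow d) / 3 * ∑ k : Fin n → ZMod 3, (chiralClockWeight a' φ k : ℂ) * omegaPow (k y - k t) := by
    simp_rw [e1]
    exact sum_mul_apply_sub_eq_of_update hxy (fun k => (chiralClockWeight a' φ k : ℂ) * omegaPow (k y - k t))
      (fun k m => by simp only [hupd, Function.update_of_ne hxy.symm, Function.update_of_ne ht]) (fun d => E d * omegaPow d)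
  have hden : ∑ k : Fin n → ZMod 3, (chiralClockWeight a' φ k : ℂ) * E (k x - k y) =
      (∑ d, E d) / 3 * ∑ k : Fin n → ZMod 3, (chiralClockWeight a' φ k : ℂ) :=
    sum_mul_apply_sub_eq_of_update hxy (fun k => (chiralClockWeight a' φ k : ℂ)) (fun k m => by simp only [hupd]) E
  rw [hnum, hden, mul_div_mul_comm, div_div_div_cancel_right₀ (three_ne_zero' ℂ)]

/-- **STRIPPING IDENTITY at the leaf, right slot**: for `b ≠ x`, `⟨ω^{k_b−k_x}⟩_a = τ' · ⟨ω^{k_b−k_y}⟩_{a'}` with `τ' = ⟨ω^{k_1−k_0}⟩`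
of the two-vertex model carrying the edge alone. [folklore] -/
theorem chiralClockCorr_strip_eq_mul_right (hxy : x ≠ y) (hleaf : ∀ z, z ≠ x → z ≠ y → a x z = 0 ∧ a z x = 0) (hxy' : a' x y = 0)
    (hyx' : a' y x = 0) (haa' : ∀ u v, ¬(u = x ∧ v = y) → ¬(u = y ∧ v = x) → a' u v = a u v) (φ : Fin n → Fin n → ℝ)
    {b : Fin n} (hb : b ≠ x) :
    chiralClockCorr a φ b x =
      chiralClockCorr (fun i j => a (![x, y] i) (![x, y] j)) (fun i j => φ (![x, y] i) (![x, y] j)) 1 0 * chiralClockCorr a' φ b y := by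
  obtain ⟨E, hE⟩ : ∃ E : ZMod 3 → ℂ, ∀ d, E d = (Real.exp (a x y * Real.cos (2 * π * ((d.val : ℕ) : ℝ) / 3 + φ x y) +
      a y x * Real.cos (2 * π * (((-d).val : ℕ) : ℝ) / 3 + φ y x)) : ℂ) := ⟨_, fun d => rfl⟩
  have hw : ∀ k : Fin n → ZMod 3, (chiralClockWeight a φ k : ℂ) = (chiralClockWeight a' φ k : ℂ) * E (k x - k y) := by
    intro k
    rw [chiralClockWeight_eq_mul_of_strip hxy hxy' hyx' haa' φ k, hE, Complex.ofReal_mul, neg_sub]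
  have hupd := chiralClockWeight_strip_update hleaf hxy' hyx' haa' φ
  have hE0 : (∑ d, E d) ≠ 0 := by
    simp_rw [hE]
    rw [← Complex.ofReal_sum]
    have : (0 : ℝ) < ∑ d : ZMod 3, Real.exp (a x y * Real.cos (2 * π * ((d.val : ℕ) : ℝ) / 3 + φ x y) +
        a y x * Real.cos (2 * π * (((-d).val : ℕ) : ℝ) / 3 + φ y x)) :=
      Finset.sum_pos (fun d _ => Real.exp_pos _) Finset.univ_nonempty
    exact_mod_cast this.ne'
  have hZ' : ∑ k : Fin n → ZMod 3, (chiralClockWeight a' φ k : ℂ) ≠ 0 := sum_chiralClockWeight_ne_zero a' φ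
  -- the pair model, pair `(1, 0)`: `h = ω^{-d}`
  have hpair : chiralClockCorr (fun i j => a (![x, y] i) (![x, y] j)) (fun i j => φ (![x, y] i) (![x, y] j)) 1 0 =
      (∑ d, E d * omegaPow (-d)) / ∑ d, E d := by
    unfold chiralClockCorr
    have e0 : ∀ k : Fin 2 → ZMod 3, k 1 - k 0 = -(k 0 - k 1) := fun k => (neg_sub (k 0) (k 1)).symm
    simp_rw [e0]
    rw [chiralClockCorr_pair_eq x y a φ (fun d => omegaPow (-d))]
    simp_rw [hE]
  rw [hpair]
  unfold chiralClockCorr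
  simp_rw [hw]
  have e1 : ∀ k : Fin n → ZMod 3, (chiralClockWeight a' φ k : ℂ) * E (k x - k y) * omegaPow (k b - k x) =
      (chiralClockWeight a' φ k : ℂ) * omegaPow (k b - k y) * (E (k x - k y) * omegaPow (-(k x - k y))) := by
    intro k
    have : k b - k x = (k b - k y) + (-(k x - k y)) := by ring
    rw [this, omegaPow_add]; ring
  have hnum : ∑ k : Fin n → ZMod 3, (chiralClockWeight a' φ k : ℂ) * E (k x - k y) * omegaPow (k b - k x) =
      (∑ d, E d * omegaPow (-d)) / 3 * ∑ k : Fin n → ZMod 3, (chiralClockWeight a' φ k : ℂ) * omegaPow (k b - k y) := by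
    simp_rw [e1]
    exact sum_mul_apply_sub_eq_of_update hxy (fun k => (chiralClockWeight a' φ k : ℂ) * omegaPow (k b - k y))
      (fun k m => by simp only [hupd, Function.update_of_ne hb, Function.update_of_ne hxy.symm]) (fun d => E d * omegaPow (-d))
  have hden : ∑ k : Fin n → ZMod 3, (chiralClockWeight a' φ k : ℂ) * E (k x - k y) =
      (∑ d, E d) / 3 * ∑ k : Fin n → ZMod 3, (chiralClockWeight a' φ k : ℂ) :=
    sum_mul_apply_sub_eq_of_update hxy (fun k => (chiralClockWeight a' φ k : ℂ)) (fun k m => by simp only [hupd]) E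
  rw [hnum, hden, mul_div_mul_comm, div_div_div_cancel_right₀ (three_ne_zero' ℂ)]

end Strip

end Summit.Ventures.YMGap.Conjectures

end
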